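import Mathlib
import Summits.Ventures.HodgeRepro2.LevelPositivity
import Summits.Ventures.HodgeRepro2.LevelSufficientlySmall
import Summits.Ventures.HodgeRepro2.LiuOscillator
import Summits.Ventures.HodgeRepro2.T6B5Data
import Summits.Ventures.HodgeRepro2.T6B5Datum
import Summits.Ventures.HodgeRepro2.T6B5Hyp
import Summits.Ventures.HodgeRepro2.T6B3Hyp
import Summits.Ventures.HodgeRepro2.T6B5Main

/-!
# T6B5Toy — Tier 6, sub-goal B5: the non-vacuity witness (README §10.5(ii)(c),(d))

For every CM field `K` with idèle conjugation `c` and quadratic character `χEF` (the cell's concrete Liu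
parameters, p2's LiuOscillator.lean), a toy datum `toyModel K c χEF : LiuAlbaneseDatum K c χEF` (trivial group,
one class, `W = ℂ`, `M̃ = ℚ`, `Ω = ℚ`, `Hom = ℚ`, one isogeny class) on which B5's two displays hold
(`toyModel_hypotheses`) AND on whose shape `shapeOf (toyModel K c χEF) _ ⊤` t6-p6's three Liu displays of
`T6B3Hyp.lean` (Thm. 4.18 isomorphism, Thm. 4.18(1), Cor. 4.20) hold as well (`toyModel_B3_hypotheses`): the five
displays consumed by `B5_main` / `B5_decomposition` are jointly satisfiable, so none is refutable from the others,
none is closed by `trivial`, and `Hyp₁ → … → False` is not provable.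
README §8(d): uses an L-value-free non-vanishing device: NO.
-/

namespace Summit.Ventures.HodgeRepro2.T6.B5Toy

open Summit.Ventures.HodgeRepro2.LevelPositivity Summit.Ventures.HodgeRepro2.ShimuraData
  Summit.Ventures.HodgeRepro2.T6.B5Data Summit.Ventures.HodgeRepro2.T6.B5Datum
  Summit.Ventures.HodgeRepro2.T6.Hyp Summit.Ventures.HodgeRepro2.T6.B5Main
open Module

universe u

variable (K : Type u) [Field K] [NumberField K] [NumberField.IsCMField K] (c : Liu.IdeleConjugation K)
  (χEF : Liu.QuadraticCharacter K c)

/-- The toy instance of the carriers (an `abbrev`, so that its fields reduce for instance search). -/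
noncomputable abbrev toyModel : LiuAlbaneseDatum K c χEF where
  n := 3
  G := Unit
  neat := fun _ => True
  IsIndex := fun _ => True
  Rep := Unit
  osc := fun _ => ()
  W := fun _ => ℂ
  ω := fun _ => Representation.trivial ℂ Unit ℂ
  mult := fun _ _ => 1
  galOrbit := ⊤
  IsogClass := Unit
  albanese := fun _ => ()
  cmVariety := fun _ => ()
  Mt := fun _ => ⊥
  Omega := fun _ => (⊥ : IntermediateField ℚ ℂ)
  ρΩ := fun _ => Representation.trivial (⊥ : IntermediateField ℚ ℂ) Unit (⊥ : IntermediateField ℚ ℂ)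
  HomQ := fun _ _ => ℚ

/-- The trivial representation of the trivial group on `ℂ` is irreducible. -/
theorem toy_isIrreducible : (Representation.trivial ℂ Unit ℂ).IsIrreducible where
  exists_pair_ne := ⟨⊥, ⊤, fun h => by
    have h' := congrArg Subrepresentation.toSubmodule h
    exact (bot_ne_top : (⊥ : Submodule ℂ ℂ) ≠ ⊤) h'⟩
  eq_bot_or_eq_top p := by
    rcases (eq_bot_or_eq_top p.toSubmodule : p.toSubmodule = ⊥ ∨ p.toSubmodule = ⊤) with h | h
    · exact Or.inl (Subrepresentation.toSubmodule_injective h)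
    · exact Or.inr (Subrepresentation.toSubmodule_injective h)

/-- Every representation of the (discrete) trivial group is smooth. -/
theorem toy_isSmooth {k V : Type*} [Field k] [AddCommGroup V] [Module k V] (ρ : Representation k Unit V) :
    IsSmooth ρ := fun _ => isOpen_discrete _

/-- Invariants of a trivial representation under any subgroup are everything. -/
theorem invariants_trivial {k G V : Type*} [Field k] [Group G] [AddCommGroup V] [Module k V] (L : Subgroup G) :
    invariants (Representation.trivial k G V) L = ⊤ :=
  eq_top_iff.mpr fun _ _ => mem_invariants_iff.mpr fun _ _ => rfl

/-- `dim_ℂ ℂ^L = 1` for the trivial representation. -/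
theorem toy_finrank_invariants_C (L : Subgroup Unit) :
    finrank ℂ (invariants (Representation.trivial ℂ Unit ℂ) L) = 1 := by
  rw [invariants_trivial, finrank_top, Module.finrank_self]

/-- `dim_ℚ (ℚ)^L = 1` for the trivial representation on `⊥ = ℚ`. -/
theorem toy_finrank_invariants_Q (L : Subgroup Unit) :
    finrank ℚ (invariants (Representation.trivial (⊥ : IntermediateField ℚ ℂ) Unit (⊥ : IntermediateField ℚ ℂ)) L)
      = 1 := by
  rw [invariants_trivial]
  rw [LinearEquiv.finrank_eq ((Submodule.topEquiv (R := (⊥ : IntermediateField ℚ ℂ))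
    (M := (⊥ : IntermediateField ℚ ℂ))).restrictScalars ℚ)]
  exact IntermediateField.finrank_bot

/-- B5's two displays hold on the toy instance. -/
theorem toyModel_hypotheses :
    Liu2021_Def4_11 (toyModel K c χEF) ∧ UllmoYafaev2014_neatInside (toyModel K c χEF) := by
  refine ⟨fun t => ⟨toy_isIrreducible, toy_isSmooth _, fun L _ => inferInstance⟩, fun L hL => ?_⟩
  refine ⟨L, hL, le_rfl, ⟨?_⟩, fun _ _ => trivial⟩
  rw [Subgroup.subgroupOf_self, Subgroup.index_top]
  exact one_ne_zero

/-- t6-p6's three Liu displays (`T6B3Hyp.lean`) hold on the shape of the toy instance (threshold `⊤`). -/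
theorem toyModel_B3_hypotheses :
    Liu2021_Thm4_18_iso (shape (toyModel K c χEF) (toyModel_hypotheses K c χEF).1 ⊤) ∧
    Liu2021_Thm4_18_1 (shape (toyModel K c χEF) (toyModel_hypotheses K c χEF).1 ⊤) ∧
    Liu2021_Cor4_20 (shape (toyModel K c χEF) (toyModel_hypotheses K c χEF).1 ⊤) := by
  classical
  refine ⟨fun t _ L _ => ?_, fun μ _ L _ => ?_, fun _ L _ => ?_⟩
  · show finrank ℂ (invariants (Representation.trivial ℂ Unit ℂ) (L.1 : Subgroup Unit)) ≤
      finrank ℚ (invariants (Representation.trivial (⊥ : IntermediateField ℚ ℂ) Unit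
        (⊥ : IntermediateField ℚ ℂ)) (L.1 : Subgroup Unit))
    rw [toy_finrank_invariants_C, toy_finrank_invariants_Q]
  · show finrank ℚ (invariants (Representation.trivial (⊥ : IntermediateField ℚ ℂ) Unit
        (⊥ : IntermediateField ℚ ℂ)) (L.1 : Subgroup Unit)) = finrank ℚ ℚ
    rw [toy_finrank_invariants_Q, Module.finrank_self]
  · -- Cor. 4.20 on the toy: one representative orbit, one triple per character when one exists.
    let reps : Finset (Liu.AutomorphicCharacter K) :=
      if h : ∃ μ, Liu.IsWeightOneConjugateSymplectic K c χEF μ then {Classical.choose h} else ∅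
    let T : Liu.AutomorphicCharacter K → Finset (Liu.OscillatorTriple K c χEF) := fun μ =>
      if h : ∃ t : Liu.OscillatorTriple K c χEF, t.μ = μ ∧ Liu.OscillatorTriple.IsAdmissible K t then
        {Classical.choose h} else ∅
    refine ⟨reps, T, ?_, ?_, ?_, ?_, ?_, @Subsingleton.elim Unit inferInstance _ _⟩
    · intro μ hμ
      simp only [reps] at hμ
      split_ifs at hμ with h
      · rw [Finset.mem_singleton] at hμ
        exact hμ ▸ Classical.choose_spec h
      · exact absurd hμ (Finset.notMem_empty _)
    · intro μ t' ht'
      simp only [T] at ht'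
      split_ifs at ht' with h
      · rw [Finset.mem_singleton] at ht'
        exact ht' ▸ Classical.choose_spec h
      · exact absurd ht' (Finset.notMem_empty _)
    · intro μ t ht htμ _
      have h : ∃ t : Liu.OscillatorTriple K c χEF, t.μ = μ ∧ Liu.OscillatorTriple.IsAdmissible K t := ⟨t, htμ, ht⟩
      refine Finset.mem_image.mpr ⟨Classical.choose h, ?_, Subtype.ext rfl⟩
      simp only [T, dif_pos h, Finset.mem_singleton]
    · intro μ hμ μ' hμ' _
      simp only [reps] at hμ hμ'
      split_ifs at hμ hμ' with h
      · rw [Finset.mem_singleton] at hμ hμ'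
        exact hμ.trans hμ'.symm
      · exact absurd hμ (Finset.notMem_empty _)
    · intro μ hμ _
      have h : ∃ μ, Liu.IsWeightOneConjugateSymplectic K c χEF μ := ⟨μ, hμ⟩
      refine ⟨Classical.choose h, ?_, trivial⟩
      simp only [reps, dif_pos h, Finset.mem_singleton]

/-- The carriers are instantiable with every display that `B5_main` / `B5_decomposition` consume true at once
(README §10.5(ii)(d)), for every choice of the cell's Liu parameters. -/
theorem exists_model : ∃ 𝓛 : LiuAlbaneseDatum K c χEF, ∃ h411 : Liu2021_Def4_11 𝓛,
    UllmoYafaev2014_neatInside 𝓛 ∧ ∃ K₀ : OpenSubgroup 𝓛.G, IsCompact (K₀ : Set 𝓛.G) ∧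
      Liu2021_Thm4_18_iso (shape 𝓛 h411 K₀) ∧ Liu2021_Thm4_18_1 (shape 𝓛 h411 K₀) ∧
      Liu2021_Cor4_20 (shape 𝓛 h411 K₀) :=
  ⟨toyModel K c χEF, (toyModel_hypotheses K c χEF).1, (toyModel_hypotheses K c χEF).2, ⊤, by simp,
    toyModel_B3_hypotheses K c χEF⟩

end Summit.Ventures.HodgeRepro2.T6.B5Toy
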